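import Summits.ResolutionOfSingularities.ResolutionOfSingularities.Theorems.UniversalCellsCampaignW82PrimeFieldTransfer
import Summits.ResolutionOfSingularities.ResolutionOfSingularities.Theorems.UniversalCellsPrimeFieldToPerfectStubSpreadOut
import Summits.ResolutionOfSingularities.ResolutionOfSingularities.Theorems.UniversalCellsPrimeFieldToPerfectOfClimbRatFuncPerf
import Summits.ResolutionOfSingularities.ResolutionOfSingularities.Theorems.UniformComplexityPrimeModelTransferOfClimbRatFuncPerf
import Summits.ResolutionOfSingularities.ResolutionOfSingularities.Theorems.UniversalCellsCampaignW82ClimbKernelGraded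
import Summits.ResolutionOfSingularities.ResolutionOfSingularities.Theorems.UniversalCellsCampaignW82FamilyTransferGradedProofs
import HarnessLib

/-!
# [OURS · L1 W8.2] PRIME-FIELD / FAMILY TRANSFER (rung B) — links DISCHARGED for the campaign statements
# of `Theorems/UniversalCellsCampaignW82PrimeFieldTransfer.lean`

Cell `res-hironaka`, LADDER-RESOLUTION rung L (RESCUE), slot W8.2; kill test K8.2 (seat res-L1-k82) came back
ALIVE (p461175, p460660, p461439). The statement-only campaign file (typer res-L1-type-o6, p460619) typed
four OURS `Prop`s at a prime `p` — `PrimeToFg p` (half (a) of crux stmt-15233), `FgToPerfect p` (half (b)),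
`ClimbRatFuncPerf p` (the registered climb kernel) and `PrimeFieldTransferAt p` (the `p`-slice of the crux) —
and proved only `Iff.rfl` / pure-logic anchors. THIS file records, sorry-free, what the tree PROVES about them:

* `primeToFg_holds : PrimeToFg p` — half (a) HOLDS outright (it is `Theorems.PrimeFieldToPerfect.stub_spreadOut`,
  p149455: transfer of FAMILIES with a regular total space; no base change).
* `climb_of_climbRatFuncPerf` — the kernel at `p` gives the full one-transcendental climb between perfect
  fields of characteristic `p` (transcendental case: `p`-local copy of
  `Theorems.PrimeFieldToPerfect.climbTranscendental_of_climbRatFuncPerf`, p156288, whose published form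
  quantifies the kernel over all primes but uses it at `p` only; algebraic case:
  `Theorems.PrimeFieldToPerfect.stub_climbAlgebraic`, p154863).
* `fgToPerfect_of_climbRatFuncPerf : ClimbRatFuncPerf p → FgToPerfect p` — half (b) REDUCES to the kernel
  (tower p152147 + separable descent p149298 + reduced ⇒ integral stmt-0551).
* `primeFieldTransferAt_of_climbRatFuncPerf : ClimbRatFuncPerf p → PrimeFieldTransferAt p`, hence
  `primeFieldToPerfect_of_forall_climbRatFuncPerf` (crux stmt-15233 ⇐ kernel at every prime) and
  `primeModelTransfer_of_forall_climbRatFuncPerf` (crux stmt-8933 ⇐ kernel at every prime; through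
  `Theorems.PrimeModelTransfer.primeModelTransfer_of_climbRatFuncPerf`, p461439): BOTH doors of slot W8.2
  hang on the ONE kernel.
* The kernel in rung-B vocabulary (`Theorems/HironakaBridge.lean`): `climbRatFuncPerf_of_perfectRes`
  (`PerfectRes p → ClimbRatFuncPerf p`, trivially) and `perfectRes_of_primeFieldRes_of_climbRatFuncPerf`
  (`PrimeFieldRes p → ClimbRatFuncPerf p → PerfectRes p`); so GIVEN resolution over the prime field the kernel
  is EQUIVALENT to resolution over all perfect fields (`perfectRes_iff_climbRatFuncPerf`) — its content is
  the METHOD (one purely inseparable climb at a time), not a weaker statement.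
* `b2_of_fgToPerfect_of_descentAt : FgToPerfect p → DescentAt p → B2 p` — the bridge's residual debt `B2`
  (finitely generated ⇒ ALL fields) splits as half (b) of THIS slot followed by the `p`-slice `DescentAt p`
  of crux stmt-0549 (slot W8.1); and `resolutionInChar_of_primeFieldRes` — under the manuscript's §17
  prime-field scope (`PrimeFieldRes p`, quoted not asserted in HironakaBridge), the summit conjunct at `p`
  follows from the kernel and `DescentAt p`.

HONEST FRAMING. Everything here is OURS or pure logic over decls of the summit's own routes
(`UniversalCells`, `UniformComplexity`, `Descent`) and the OURS bridge file; NOTHING is a statement of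
H. Hironaka's 2017 manuscript, nothing is attributed to its author, and no typed candidate of the manuscript
is used even as a hypothesis. The kernel `ClimbRatFuncPerf p` stays OPEN (summit-implied; open-problem grade
per `Cruxes/PrimeFieldToPerfect/KERNEL*.md`); no claim is made about it. AI work, weaker than expert review.

## References (vocabulary only)
* plan/RESCUE-SEED.md row W8.2; L/res-L1-k82/KILL-TEST-K8.2.md; plan/RUNG-B.md §2 — cell files, OURS.
* Q. Liu, *Algebraic Geometry and Arithmetic Curves* (2002), Prop. 3.2.7, Cor. 4.3.33 (perfect closure,
  smooth vs regular) — used by the tree proofs named above. [Liu2002]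
-/

noncomputable section

set_option linter.dupNamespace false -- mandated namespace of this single-conjunct summit

open _root_.CategoryTheory _root_.CategoryTheory.Limits _root_.AlgebraicGeometry
open Literature.AlgebraicGeometry.Resolution
open Summit.ResolutionOfSingularities.ResolutionOfSingularities.Theorems
  (PerfectRes PrimeFieldRes FgLevelRes B2 DescentAt)

namespace Summit.ResolutionOfSingularities.ResolutionOfSingularities.Theorems.CampaignW82

/-! ## Half (a) holds -/

/-- **Half (a) of slot W8.2 HOLDS**: `PrimeToFg p` is, binder for binder, the landed
`Theorems.PrimeFieldToPerfect.stub_spreadOut` (spreading out over a finitely generated `𝔽_p`-algebra,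
resolving the TOTAL SPACE as an `𝔽_p`-scheme, generic fibre). [folklore] -/
theorem primeToFg_holds (p : ℕ) [Fact p.Prime] : PrimeToFg p :=
  fun h K _ _ hK X f hs hl hq hX =>
    PrimeFieldToPerfect.stub_spreadOut p Fact.out h K hK X f hs hl hq hX

/-! ## The kernel gives the one-transcendental climb, and half (b) -/

/-- **The kernel at `p` gives the one-transcendental climb between perfect fields of characteristic `p`**:
`M` perfect with resolution of all integral separated finite-type `M`-schemes, `L ⊇ M` perfect, `t ∈ L`
with `L` algebraic over `M(t)` ⇒ resolution over `L`. Transcendental `t`: `M(t) ≅ RatFunc M`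
(`RatFunc.algEquivOfTranscendental`), the kernel resolves over the relative perfect closure
`L₀ = perfectClosure M(t) L`, and `L / L₀` is algebraic (`stub_climbAlgebraic`); algebraic `t`: `L / M` is
algebraic (`stub_climbAlgebraic` directly). `p`-local copy of p156288 + RESHAPE 3's case split. [folklore] -/
theorem climb_of_climbRatFuncPerf {p : ℕ} [Fact p.Prime] (hR : ClimbRatFuncPerf p)
    (M : Type) [Field M] [CharP M p] [PerfectField M]
    (hM : ∀ (X : Scheme.{0}) (f : X ⟶ Spec (.of M)), IsSeparated f → LocallyOfFiniteType f →
      QuasiCompact f → IsIntegral X → Scheme.HasResolution X)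
    (L : Type) [Field L] [PerfectField L] [Algebra M L] (t : L)
    (ht : Algebra.IsAlgebraic (IntermediateField.adjoin M ({t} : Set L)) L)
    (X : Scheme.{0}) (f : X ⟶ Spec (.of L)) (hs : IsSeparated f) (hl : LocallyOfFiniteType f)
    (hq : QuasiCompact f) (hX : IsIntegral X) : Scheme.HasResolution X := by
  -- adapted from Theorems/UniversalCellsPrimeFieldToPerfectClimbOfRatFuncPerf.lean (p156288)
  by_cases htr : Transcendental M t
  · -- `E = M⟮t⟯ ⊆ L` and its relative perfect closure `L₀` in `L`
    let E : IntermediateField M L := IntermediateField.adjoin M ({t} : Set L)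
    let L₀ : IntermediateField E L := perfectClosure E L
    haveI : PerfectField L₀ := inferInstanceAs (PerfectField (perfectClosure E L))
    haveI : IsPurelyInseparable E L₀ := perfectClosure.isPurelyInseparable E L
    -- `RatFunc M ≅ E` (t transcendental) makes `L₀` a purely inseparable `RatFunc M`-algebra
    let e : RatFunc M ≃ₐ[M] E := RatFunc.algEquivOfTranscendental t htr
    letI : Algebra (RatFunc M) E := (e : RatFunc M →+* E).toAlgebra
    letI : Algebra (RatFunc M) L₀ := ((algebraMap E L₀).comp (e : RatFunc M →+* E)).toAlgebra
    haveI : IsScalarTower (RatFunc M) E L₀ := IsScalarTower.of_algebraMap_eq fun _ => rfl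
    haveI : IsPurelyInseparable (RatFunc M) E :=
      { isIntegral := Algebra.isIntegral_of_surjective (fun x => ⟨e.symm x, e.apply_symm_apply x⟩)
        inseparable' := fun x _ => ⟨e.symm x, e.apply_symm_apply x⟩ }
    haveI : IsPurelyInseparable (RatFunc M) L₀ := IsPurelyInseparable.trans (RatFunc M) E L₀
    -- the kernel: resolution over `L₀ ≅ (RatFunc M)^{perf}`
    have hL₀ : ∀ (Y : Scheme.{0}) (g : Y ⟶ Spec (.of L₀)), IsSeparated g → LocallyOfFiniteType g →
        QuasiCompact g → IsIntegral Y → Scheme.HasResolution Y :=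
      fun Y g hs' hl' hq' hY => hR M hM L₀ Y g hs' hl' hq' hY
    -- `L` is algebraic over `E ⊆ L₀`, hence over the perfect `L₀`: the landed algebraic case
    haveI : Algebra.IsAlgebraic E L := ht
    haveI : Algebra.IsAlgebraic L₀ L := Algebra.IsAlgebraic.tower_top (K := E) L₀
    exact PrimeFieldToPerfect.stub_climbAlgebraic L₀ hL₀ L X f hs hl hq hX
  · -- `t` algebraic: `M⟮t⟯/M` is finite, `L/M⟮t⟯` algebraic, so `L/M` is algebraic
    have halg : IsAlgebraic M t := Classical.not_not.mp htr
    haveI : FiniteDimensional M (IntermediateField.adjoin M ({t} : Set L)) :=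
      IntermediateField.adjoin.finiteDimensional halg.isIntegral
    haveI : Algebra.IsAlgebraic M (IntermediateField.adjoin M ({t} : Set L)) :=
      Algebra.IsAlgebraic.of_finite M _
    haveI : Algebra.IsAlgebraic (IntermediateField.adjoin M ({t} : Set L)) L := ht
    haveI : Algebra.IsAlgebraic M L :=
      Algebra.IsAlgebraic.trans M (IntermediateField.adjoin M ({t} : Set L)) L
    exact PrimeFieldToPerfect.stub_climbAlgebraic M hM L X f hs hl hq hX

/-- Resolution of integral separated finite-type schemes over the prime field `ZMod p` from the
hypothesis of `FgToPerfect p` (resolution over every finitely generated field of characteristic `p`):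
`ZMod p` is finitely generated as a field — by the empty set, every element being an integer cast.
[folklore] -/
theorem primeField_of_fgHyp {p : ℕ} [Fact p.Prime]
    (h : ∀ (K : Type) [Field K] [CharP K p], (∃ s : Finset K, Subfield.closure (s : Set K) = ⊤) →
      ∀ (X : Scheme.{0}) (f : X ⟶ Spec (.of K)),
        IsSeparated f → LocallyOfFiniteType f → QuasiCompact f → IsIntegral X → Scheme.HasResolution X) :
    ∀ (X : Scheme.{0}) (f : X ⟶ Spec (.of (ZMod p))), IsSeparated f → LocallyOfFiniteType f →
      QuasiCompact f → IsIntegral X → Scheme.HasResolution X := by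
  refine h (ZMod p) ⟨∅, eq_top_iff.2 fun x _ => ?_⟩
  obtain ⟨n, rfl⟩ := ZMod.intCast_surjective x
  exact intCast_mem _ n

/-- **Half (b) of slot W8.2 reduces to the kernel**: `ClimbRatFuncPerf p → FgToPerfect p`. Chain, all by
tree names: kernel ⇒ one-transcendental climb (`climb_of_climbRatFuncPerf`) ⇒ perfect closures of finitely
generated fields (`PrimeFieldToPerfect.stub_tower`, fed over `ZMod p` by `primeField_of_fgHyp`) ⇒ all
perfect fields, integral schemes (`PrimeFieldToPerfect.stub_separableDescent`) ⇒ reduced schemes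
(`Theorems.descentReducedToIntegral_proof`, stmt-0551). [folklore] -/
theorem fgToPerfect_of_climbRatFuncPerf (p : ℕ) [Fact p.Prime] (hR : ClimbRatFuncPerf p) :
    FgToPerfect p := by
  intro hFg k _ _ _ X f hs hl hq hr
  have hp : p.Prime := Fact.out
  have h₀ := primeField_of_fgHyp hFg
  -- ⇒ perfect closures of finitely generated fields (stub_tower)
  have hPC : ∀ (K : Type) [Field K] [CharP K p], (∃ s : Finset K, Subfield.closure (s : Set K) = ⊤) →
      ∀ (L : Type) [Field L] [PerfectField L] [Algebra K L] [IsPurelyInseparable K L]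
        (Y : Scheme.{0}) (g : Y ⟶ Spec (.of L)), IsSeparated g → LocallyOfFiniteType g →
          QuasiCompact g → IsIntegral Y → Scheme.HasResolution Y :=
    fun K _ _ hK L _ _ _ _ Y g hs' hl' hq' hY =>
      PrimeFieldToPerfect.stub_tower p hp h₀
        (fun M _ _ _ hM L _ _ _ _ t ht => climb_of_climbRatFuncPerf hR M hM L t ht) K hK L Y g hs' hl' hq' hY
  -- ⇒ all perfect fields, integral schemes (stub_separableDescent)
  have hInt : ∀ (Y : Scheme.{0}) (g : Y ⟶ Spec (.of k)), IsSeparated g → LocallyOfFiniteType g →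
      QuasiCompact g → IsIntegral Y → Scheme.HasResolution Y :=
    fun Y g hs' hl' hq' hint => PrimeFieldToPerfect.stub_separableDescent p hp hPC k Y g hs' hl' hq' hint
  -- ⇒ reduced schemes over the fixed perfect field `k` (stmt-0551)
  exact Summit.ResolutionOfSingularities.ResolutionOfSingularities.Theorems.descentReducedToIntegral_proof
    k hInt X f hs hl hq hr

/-- **The `p`-slice of crux stmt-15233 from the kernel at `p`** (half (a) holds, half (b) reduces to the
kernel, and the split is pure logic). [folklore] -/
theorem primeFieldTransferAt_of_climbRatFuncPerf (p : ℕ) [Fact p.Prime] (hR : ClimbRatFuncPerf p) :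
    PrimeFieldTransferAt p :=
  primeFieldTransferAt_of_primeToFg_of_fgToPerfect (primeToFg_holds p) (fgToPerfect_of_climbRatFuncPerf p hR)

/-- **Door 1 of slot W8.2 hangs on the kernel**: the crux `Theses.UniversalCells.PrimeFieldToPerfect`
(stmt-ResolutionOfSingularities-15233) follows from `ClimbRatFuncPerf p` at every prime `p` (same content as
`Theorems.PrimeFieldToPerfect.primeFieldToPerfect_of_climbRatFuncPerf`, p158667, re-derived `p`-locally).
[folklore] -/
theorem primeFieldToPerfect_of_forall_climbRatFuncPerf (hR : ∀ p : ℕ, p.Prime → ClimbRatFuncPerf p) :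
    Summit.ResolutionOfSingularities.ResolutionOfSingularities.Theses.UniversalCells.PrimeFieldToPerfect :=
  primeFieldToPerfect_iff.2 fun p hp =>
    haveI : Fact p.Prime := ⟨hp⟩
    primeFieldTransferAt_of_climbRatFuncPerf p (hR p hp)

/-- **Door 2 of slot W8.2 hangs on the SAME kernel**: the crux `Theses.UniformComplexity.PrimeModelTransfer`
(stmt-ResolutionOfSingularities-8933: `𝔽_p`-bar ⇒ every algebraically closed field of characteristic `p`)
follows from `ClimbRatFuncPerf p` at every prime `p` — through
`Theorems.PrimeModelTransfer.primeModelTransfer_of_climbRatFuncPerf` (p461439; tower from a perfect base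
p461175 + descent to the perfect closures of finitely generated subextensions p460660). [folklore] -/
theorem primeModelTransfer_of_forall_climbRatFuncPerf (hR : ∀ p : ℕ, p.Prime → ClimbRatFuncPerf p) :
    Summit.ResolutionOfSingularities.ResolutionOfSingularities.Theses.UniformComplexity.PrimeModelTransfer :=
  PrimeModelTransfer.primeModelTransfer_of_climbRatFuncPerf
    (fun p hp M _ _ _ hM L _ _ _ _ X f hs hl hq hX => hR p hp M hM L X f hs hl hq hX)

/-! ## The kernel in rung-B vocabulary (`Theorems/HironakaBridge.lean`) -/

/-- `PerfectRes p → ClimbRatFuncPerf p`: resolution over all perfect fields of characteristic `p` contains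
the kernel, since a perfect field purely inseparable over `RatFunc M` (`M` of characteristic `p`) has
characteristic `p` and an integral scheme is reduced. In particular the kernel is implied by the summit
conjunct at `p` (`Theorems.perfectRes_of_resolutionInChar`). [folklore] -/
theorem climbRatFuncPerf_of_perfectRes {p : ℕ} [Fact p.Prime] (h : PerfectRes p) : ClimbRatFuncPerf p := by
  intro M _ _ _ _ L _ _ _ _ X f hs hl hq hX
  haveI : CharP (RatFunc M) p := inferInstance
  haveI : CharP L p := charP_of_injective_algebraMap (algebraMap (RatFunc M) L).injective p
  haveI : IsReduced X := inferInstance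
  exact h L X f hs hl hq inferInstance

/-- `PrimeFieldRes p → ClimbRatFuncPerf p → PerfectRes p`: given resolution over the prime field, the kernel
yields resolution over every perfect field of characteristic `p` (through `primeFieldTransferAt_of_climbRatFuncPerf`;
`PrimeFieldRes p` speaks of reduced schemes, which contain the integral ones). [folklore] -/
theorem perfectRes_of_primeFieldRes_of_climbRatFuncPerf {p : ℕ} [Fact p.Prime] (h0 : PrimeFieldRes p)
    (hR : ClimbRatFuncPerf p) : PerfectRes p :=
  fun k _ _ _ X f hs hl hq hr =>
    primeFieldTransferAt_of_climbRatFuncPerf p hR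
      (fun Y g hs' hl' hq' hY => h0 Y g hs' hl' hq' (by haveI := hY; infer_instance)) k X f hs hl hq hr

/-- **Given resolution over the prime field, the kernel IS resolution over all perfect fields**
(`PerfectRes p ↔ ClimbRatFuncPerf p` under `PrimeFieldRes p`): the kernel is a reformulation whose content is
the method — one purely inseparable climb `M ↦ M(t)^{perf}` at a time — not a logically weaker target.
[folklore] -/
theorem perfectRes_iff_climbRatFuncPerf {p : ℕ} [Fact p.Prime] (h0 : PrimeFieldRes p) :
    PerfectRes p ↔ ClimbRatFuncPerf p :=
  ⟨climbRatFuncPerf_of_perfectRes, perfectRes_of_primeFieldRes_of_climbRatFuncPerf h0⟩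

/-- The hypothesis of `FgToPerfect p` (resolution over every finitely generated field of characteristic `p`,
integral schemes) from the bridge's `FgLevelRes p` (resolution over every subfield `closure t` of every
field of characteristic `p`, reduced schemes): take `L = ⊤ = closure s ⊆ K` and compose with
`Spec K ≅ Spec ↥⊤`. [folklore] -/
theorem fgHyp_of_fgLevelRes {p : ℕ} (h : FgLevelRes p) :
    ∀ (K : Type) [Field K] [CharP K p], (∃ s : Finset K, Subfield.closure (s : Set K) = ⊤) →
      ∀ (X : Scheme.{0}) (f : X ⟶ Spec (.of K)),
        IsSeparated f → LocallyOfFiniteType f → QuasiCompact f → IsIntegral X → Scheme.HasResolution X := by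
  intro K _ _ hK X f hs hl hq hX
  obtain ⟨s, hsK⟩ := hK
  haveI : IsSeparated f := hs
  haveI : LocallyOfFiniteType f := hl
  haveI : QuasiCompact f := hq
  -- `Spec K ≅ Spec ↥(⊤ : Subfield K)`
  let e : (⊤ : Subfield K) ≃+* K := Subfield.topEquiv
  let ι : Spec (.of K) ⟶ Spec (.of (⊤ : Subfield K)) := Spec.map (CommRingCat.ofHom e.toRingHom)
  haveI : IsIso ι := inferInstanceAs (IsIso (Spec.map e.toCommRingCatIso.hom))
  exact h K ⊤ s hsK.symm X (f ≫ ι) inferInstance inferInstance inferInstance inferInstance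

/-- **The bridge's residual debt splits through this slot**: `FgToPerfect p → DescentAt p → B2 p` —
finitely generated fields ⇒ (half (b) of W8.2) all perfect fields ⇒ (the `p`-slice `DescentAt p` of crux
stmt-0549, slot W8.1) all fields of characteristic `p`. [folklore] -/
theorem b2_of_fgToPerfect_of_descentAt (p : ℕ) (hb : FgToPerfect p) (hd : DescentAt p) : B2 p :=
  fun hFg => hd (hb (fgHyp_of_fgLevelRes hFg))

/-- **Rung B under the prime-field scope, priced**: resolution over `ZMod p` (`PrimeFieldRes p`, the scope
sentence §17 p.89 l.59–60 quoted — not asserted — in `Theorems/HironakaBridge.lean`), the kernel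
`ClimbRatFuncPerf p` (slot W8.2) and `DescentAt p` (slot W8.1, crux stmt-0549 at `p`) give the summit conjunct
`ResolutionInChar p`. [folklore] -/
theorem resolutionInChar_of_primeFieldRes {p : ℕ} [Fact p.Prime] (h0 : PrimeFieldRes p)
    (hR : ClimbRatFuncPerf p) (hd : DescentAt p) : ResolutionInChar.{0} p :=
  hd (perfectRes_of_primeFieldRes_of_climbRatFuncPerf h0 hR)

/-- **Rung B under the prime-field scope is EXACTLY slot W8.1's descent slice plus slot W8.2's kernel**:
`(PrimeFieldRes p → ResolutionInChar p) ↔ DescentAt p ∧ (PrimeFieldRes p → ClimbRatFuncPerf p)`.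
(⇒): `DescentAt p` because `PerfectRes p` contains `PrimeFieldRes p`; the kernel because the summit conjunct at
`p` contains `PerfectRes p`, which contains the kernel. (⇐): `resolutionInChar_of_primeFieldRes`. Pure logic
over OURS predicates; nothing asserted. [folklore] -/
theorem primeFieldScope_iff_descentAt_and_climb (p : ℕ) [Fact p.Prime] :
    (PrimeFieldRes p → ResolutionInChar.{0} p) ↔ (DescentAt p ∧ (PrimeFieldRes p → ClimbRatFuncPerf p)) := by
  constructor
  · intro h
    refine ⟨fun hP => h
      (Summit.ResolutionOfSingularities.ResolutionOfSingularities.Theorems.primeFieldRes_of_perfectRes hP),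
      fun h0 => climbRatFuncPerf_of_perfectRes ?_⟩
    exact Summit.ResolutionOfSingularities.ResolutionOfSingularities.Theorems.perfectRes_of_resolutionInChar
      (h h0)
  · rintro ⟨hd, hk⟩ h0
    exact resolutionInChar_of_primeFieldRes h0 (hk h0) hd

/-! ## The dimension-graded kernel (`…CampaignW82ClimbKernelGraded`, p466046) against the kernel BY NAME -/

/-- **The top grade of the dimension-graded kernel is the registered kernel, by name**:
`ClimbRatFuncPerfDimLe p ⊤ ⊤ ↔ ClimbRatFuncPerf p` (the Theses-free module p466046 states this against
the kernel's body, `climbRatFuncPerfDimLe_top_iff`; here, leaf-side, with the NAME — the two right-hand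
sides agree syntactically). [folklore] -/
theorem climbRatFuncPerfDimLe_top_top_iff (p : ℕ) : ClimbRatFuncPerfDimLe p ⊤ ⊤ ↔ ClimbRatFuncPerf p :=
  climbRatFuncPerfDimLe_top_iff p

/-- **The kernel gives every grade with idle hypothesis bound**: `ClimbRatFuncPerf p → ClimbRatFuncPerfDimLe p ⊤ n`
for every `n` (top grade by name, then antitonicity in `n`, `climbRatFuncPerfDimLe_mono`). The converse
direction `(⊤, n) for all n ⇒ kernel` also holds (take `n := topologicalKrullDim X`), see
`climbRatFuncPerf_of_forall_climbRatFuncPerfDimLe_top`. [folklore] -/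
theorem climbRatFuncPerfDimLe_top_of_climbRatFuncPerf {p : ℕ} (h : ClimbRatFuncPerf p) (n : WithBot ℕ∞) :
    ClimbRatFuncPerfDimLe p ⊤ n :=
  climbRatFuncPerfDimLe_mono le_rfl le_top ((climbRatFuncPerfDimLe_top_top_iff p).2 h)

/-- Conversely, the grades `(⊤, n)` for all `n` give back the kernel (each scheme has SOME dimension
`topologicalKrullDim X : WithBot ℕ∞`); so `ClimbRatFuncPerf p ↔ ∀ n, ClimbRatFuncPerfDimLe p ⊤ n`. [folklore] -/
theorem climbRatFuncPerf_of_forall_climbRatFuncPerfDimLe_top {p : ℕ}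
    (h : ∀ n : WithBot ℕ∞, ClimbRatFuncPerfDimLe p ⊤ n) : ClimbRatFuncPerf p :=
  (climbRatFuncPerfDimLe_top_top_iff p).1 (h ⊤)

/-- `ClimbRatFuncPerf p ↔ ∀ n, ClimbRatFuncPerfDimLe p ⊤ n`: the kernel is the conjunction of its grades
with idle hypothesis bound. [folklore] -/
theorem climbRatFuncPerf_iff_forall_climbRatFuncPerfDimLe_top (p : ℕ) :
    ClimbRatFuncPerf p ↔ ∀ n : WithBot ℕ∞, ClimbRatFuncPerfDimLe p ⊤ n :=
  ⟨fun h n => climbRatFuncPerfDimLe_top_of_climbRatFuncPerf h n,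
    climbRatFuncPerf_of_forall_climbRatFuncPerfDimLe_top⟩

/-! ## Both doors of slot W8.2 hang on the PERFECTION STEP alone (finite levels proved,
`…CampaignW82FamilyTransferGradedProofs`, res-L1-s82-pv-1) -/

/-- **The kernel BY NAME from the perfection step at grade `⊤`**: `PerfectionStepDimLe p ⊤ → ClimbRatFuncPerf p`
(finite level `SpreadOutRatFuncDimLe p ⊤ ⊤` is the theorem `spreadOutRatFuncDimLe_top_top`; top grade = kernel
by `climbRatFuncPerfDimLe_top_top_iff`). [folklore] -/
theorem climbRatFuncPerf_of_perfectionStepDimLe_top {p : ℕ} (h : PerfectionStepDimLe p ⊤) :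
    ClimbRatFuncPerf p :=
  (climbRatFuncPerfDimLe_top_top_iff p).1 (climbRatFuncPerfDimLe_top_top_of_perfectionStep_top h)

/-- **Door 1 hangs on the perfection step**: the crux `Theses.UniversalCells.PrimeFieldToPerfect`
(stmt-ResolutionOfSingularities-15233) follows from `PerfectionStepDimLe p ⊤` at every prime `p`. [folklore] -/
theorem primeFieldToPerfect_of_forall_perfectionStepDimLe_top
    (h : ∀ p : ℕ, p.Prime → PerfectionStepDimLe p ⊤) :
    Summit.ResolutionOfSingularities.ResolutionOfSingularities.Theses.UniversalCells.PrimeFieldToPerfect :=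
  primeFieldToPerfect_of_forall_climbRatFuncPerf fun p hp => climbRatFuncPerf_of_perfectionStepDimLe_top (h p hp)

/-- **Door 2 hangs on the same perfection step**: the crux `Theses.UniformComplexity.PrimeModelTransfer`
(stmt-ResolutionOfSingularities-8933) follows from `PerfectionStepDimLe p ⊤` at every prime `p`. [folklore] -/
theorem primeModelTransfer_of_forall_perfectionStepDimLe_top
    (h : ∀ p : ℕ, p.Prime → PerfectionStepDimLe p ⊤) :
    Summit.ResolutionOfSingularities.ResolutionOfSingularities.Theses.UniformComplexity.PrimeModelTransfer :=
  primeModelTransfer_of_forall_climbRatFuncPerf fun p hp => climbRatFuncPerf_of_perfectionStepDimLe_top (h p hp)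

/-- Under the prime-field scope `PrimeFieldRes p` of the bridge, resolution over all perfect fields of
characteristic `p` (`PerfectRes p`) follows from the perfection step at `⊤`. [folklore] -/
theorem perfectRes_of_primeFieldRes_of_perfectionStepDimLe_top {p : ℕ} [Fact p.Prime] (h0 : PrimeFieldRes p)
    (h : PerfectionStepDimLe p ⊤) : PerfectRes p :=
  perfectRes_of_primeFieldRes_of_climbRatFuncPerf h0 (climbRatFuncPerf_of_perfectionStepDimLe_top h)

end Summit.ResolutionOfSingularities.ResolutionOfSingularities.Theorems.CampaignW82

end
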